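import Mathlib
import HarnessLib
import Summits.Ventures.LatticeQCDFlow.Exactness.FlowPushforward
import Summits.Ventures.LatticeQCDFlow.Exactness.SU2TorusAlcoveJacobian
import Summits.Ventures.LatticeQCDFlow.Scaling.EntropyBudgetCoupling

/-!
# Box coupling layers and their compositions (autoregressive box flows) are exact for Lebesgue measure on the cube, with the product of the one-coordinate derivatives

HONEST FRAMING: exact (Metropolis-corrected) sampling algorithms for lattice gauge theory;
figures of merit are autocorrelation/cost numbers at stated couplings and volumes; no
continuum-physics claim.

Venture `LatticeQCDFlow` (cell pub-lqcd), topic `Exactness`; FANOUT row 10 (`eng-equiv`, engine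
`latflow.equiv` `spectral._box_flow`: "boundary-preserving flow on the box `(0,1)^n`; independent
mode: coordinate-wise splines; AUTOREGRESSIVE mode (v0.2, Boyda et al. 2021 §IV.A): coordinate
`j ≥ 1` takes its spline parameters from the already-transformed coordinates `< j`; the Jacobian is
triangular and `log|det|` is STILL the sum of the 1-d spline log-derivatives"; `flow.py` "exact
accumulated log-det").  NEW WORK of the cell over row 31's `Theory2.hasJacobian_coupleFun` (a
coupling layer on a product space is exact with the product of the fibre Jacobians) and this row's
`SU2TorusAlcoveJacobian.hasJacobian_volume_restrict_of_monotoneOn` (one coordinate).  Nothing is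
cited as a fact; no number; no definition.  Printed counterparts, NAMED ONLY: Durkan et al. 2019
(neural spline flows: autoregressive / coupling transforms have triangular Jacobians); Boyda et al.,
PRD 103 (2021) 074504 §IV.A.

## What is typed (`ι` finite; the cube `ι → ℝ` with `⊗_ι Leb|_[0,1]`)

* **`hasJacobian_boxCoupleFun`** — a coupling layer `Theory2.coupleFun p χ` whose active
  coordinates `a` are moved by self-maps `χ a y` of `[0, 1]` (measurable and monotone on `[0,1]`,
  onto, derivative `χ' a y ≥ 0` within `[0,1]`; parameters `y` = the frozen coordinates, jointly
  measurable) has `HasJacobian (⊗ Leb|_[0,1]) (coupleFun p χ) (ofReal ∘ coupleJac p χ')` — the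
  independent-mode box flow of the engine with any mask;
* **`HasJacobian.foldl_comp`** — a LIST of exact layers composes to an exact flow whose Jacobian
  is the product of the layer Jacobians along the trajectory (`flow.py`'s accumulated log-det);
* **`hasJacobian_boxFlow_sequential`** — hence any finite SEQUENCE of box coupling layers (masks
  `p k`, maps `χ k`) is exact with the accumulated product: the AUTOREGRESSIVE box flow is the case
  `p k = (· = k)` (coordinate `k` moved given all the others, which at stage `k` are the transformed
  `< k` and the untouched `> k`).

NOT here: the cell/simplex chart that carries the box to the Weyl alcove for `N ≥ 3`; any number.
-/

noncomputable section

namespace Summit.Ventures.LatticeQCDFlow.Exactness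

open MeasureTheory Set
open scoped ENNReal

/-! ## Lists of exact layers compose -/

section Compose

variable {Ω : Type*} [MeasurableSpace Ω]

/-- **A list of exact layers composes to an exact flow** (log-dets add along the trajectory): folding
`(F, J) ↦ (f ∘ F, z ↦ J z · J_f (F z))` over a list of layers `(f, J_f)` each with
`HasJacobian vol f J_f`, starting from any exact `(F, J)`, yields an exact pair. -/
theorem HasJacobian.foldl_comp {vol : Measure Ω} (L : List ((Ω → Ω) × (Ω → ℝ≥0∞)))
    (hL : ∀ l ∈ L, HasJacobian vol l.1 l.2) {F : Ω → Ω} {J : Ω → ℝ≥0∞} (hF : HasJacobian vol F J) :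
    HasJacobian vol
      (L.foldl (fun (q : (Ω → Ω) × (Ω → ℝ≥0∞)) l => (l.1 ∘ q.1, fun z => q.2 z * l.2 (q.1 z))) (F, J)).1
      (L.foldl (fun (q : (Ω → Ω) × (Ω → ℝ≥0∞)) l => (l.1 ∘ q.1, fun z => q.2 z * l.2 (q.1 z))) (F, J)).2 := by
  induction L generalizing F J with
  | nil => simpa using hF
  | cons l L ih =>
    rw [List.foldl_cons]
    refine ih (fun l' hl' => hL l' (List.mem_cons_of_mem _ hl')) ?_
    have h := (hL l (List.mem_cons_self)).comp hF
    refine ⟨h.measurable, ?_, ?_⟩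
    · exact hF.measurable_jac.mul ((hL l List.mem_cons_self).measurable_jac.comp hF.measurable)
    · have hJ : (fun z => J z * l.2 (F z)) = fun z => l.2 (F z) * J z := funext fun z => mul_comm _ _
      rw [hJ]
      exact h.map_eq

/-- The same started from the identity: the flow of the list `L` (first layer applied first) is
exact with the accumulated product of Jacobians. -/
theorem hasJacobian_foldl_layers {vol : Measure Ω} (L : List ((Ω → Ω) × (Ω → ℝ≥0∞)))
    (hL : ∀ l ∈ L, HasJacobian vol l.1 l.2) :
    HasJacobian vol
      (L.foldl (fun (q : (Ω → Ω) × (Ω → ℝ≥0∞)) l => (l.1 ∘ q.1, fun z => q.2 z * l.2 (q.1 z)))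
        (id, fun _ => 1)).1
      (L.foldl (fun (q : (Ω → Ω) × (Ω → ℝ≥0∞)) l => (l.1 ∘ q.1, fun z => q.2 z * l.2 (q.1 z)))
        (id, fun _ => 1)).2 :=
  HasJacobian.foldl_comp L hL (hasJacobian_id vol)

end Compose

/-! ## Box coupling layers -/

section Box

variable {ι : Type*} [Fintype ι]

/-- **A box coupling layer is exact for Lebesgue on the cube.**  On `ι → ℝ` with
`⊗_ι Leb|_[0,1]` and an active predicate `p`: if each active coordinate `a` is moved, given the
frozen coordinates `y`, by a map `χ a y : ℝ → ℝ` that is measurable jointly in `(u, y)`, monotone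
on `[0, 1]` with `χ a y '' [0,1] = [0,1]` and derivative `χ' a y u ≥ 0` within `[0, 1]` (jointly
measurable), then `coupleFun p χ` has `HasJacobian (⊗ Leb|_[0,1]) _ (ofReal ∘ coupleJac p χ')`:
the product of the one-coordinate derivatives at the active coordinates is an exact Jacobian. -/
theorem hasJacobian_boxCoupleFun (p : ι → Prop) [DecidablePred p]
    {χ χ' : {i // p i} → ({i // ¬p i} → ℝ) → ℝ → ℝ}
    (hχ : ∀ a, Measurable fun q : ℝ × ({i // ¬p i} → ℝ) => χ a q.2 q.1)
    (hχ' : ∀ a, Measurable fun q : ℝ × ({i // ¬p i} → ℝ) => χ' a q.2 q.1)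
    (hderiv : ∀ a y, ∀ u ∈ Icc (0 : ℝ) 1, HasDerivWithinAt (χ a y) (χ' a y u) (Icc 0 1) u)
    (hmono : ∀ a y, MonotoneOn (χ a y) (Icc 0 1)) (himage : ∀ a y, χ a y '' Icc 0 1 = Icc 0 1)
    (hχ'0 : ∀ a y u, 0 ≤ χ' a y u) :
    HasJacobian (Measure.pi fun _ : ι => (volume.restrict (Icc (0 : ℝ) 1) : Measure ℝ))
      (Theory2.coupleFun p χ) fun U => ENNReal.ofReal (Theory2.coupleJac p χ' U) := by
  refine Theory2.hasJacobian_coupleFun (volume.restrict (Icc (0 : ℝ) 1)) hχ hχ' (fun a y => ?_) hχ'0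
  have hχy : Measurable (χ a y) := (hχ a).comp (measurable_id.prodMk measurable_const)
  have hχ'y : Measurable (χ' a y) := (hχ' a).comp (measurable_id.prodMk measurable_const)
  exact hasJacobian_volume_restrict_of_monotoneOn measurableSet_Icc hχy hχ'y (hderiv a y) (hmono a y) (himage a y)

/-- **Sequential box flows (the autoregressive box flow included) are exact.**  A finite sequence
of box coupling layers — stage `k` with mask `p k` and maps `χ k` / derivatives `χ' k` as in
`hasJacobian_boxCoupleFun` — composes to a flow with
`HasJacobian (⊗ Leb|_[0,1]) (flow) (accumulated product of the stage Jacobians along the trajectory)`.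
With `p k = (· = c k)` for a list of coordinates `c k` this is the engine's AUTOREGRESSIVE mode:
coordinate `c k` is moved given the current values of all other coordinates (the transformed earlier
ones and the untouched later ones), and the booked log-det is the sum of the one-coordinate
log-derivatives. -/
theorem hasJacobian_boxFlow_sequential {m : ℕ} (p : Fin m → ι → Prop) [∀ k, DecidablePred (p k)]
    (χ χ' : (k : Fin m) → {i // p k i} → ({i // ¬p k i} → ℝ) → ℝ → ℝ)
    (hχ : ∀ k a, Measurable fun q : ℝ × ({i // ¬p k i} → ℝ) => χ k a q.2 q.1)
    (hχ' : ∀ k a, Measurable fun q : ℝ × ({i // ¬p k i} → ℝ) => χ' k a q.2 q.1)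
    (hderiv : ∀ k a y, ∀ u ∈ Icc (0 : ℝ) 1, HasDerivWithinAt (χ k a y) (χ' k a y u) (Icc 0 1) u)
    (hmono : ∀ k a y, MonotoneOn (χ k a y) (Icc 0 1)) (himage : ∀ k a y, χ k a y '' Icc 0 1 = Icc 0 1)
    (hχ'0 : ∀ k a y u, 0 ≤ χ' k a y u) :
    HasJacobian (Measure.pi fun _ : ι => (volume.restrict (Icc (0 : ℝ) 1) : Measure ℝ))
      (((List.finRange m).map fun k => (Theory2.coupleFun (p k) (χ k),
          fun U : ι → ℝ => ENNReal.ofReal (Theory2.coupleJac (p k) (χ' k) U))).foldl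
        (fun (q : ((ι → ℝ) → (ι → ℝ)) × ((ι → ℝ) → ℝ≥0∞)) l => (l.1 ∘ q.1, fun z => q.2 z * l.2 (q.1 z)))
        (id, fun _ => 1)).1
      (((List.finRange m).map fun k => (Theory2.coupleFun (p k) (χ k),
          fun U : ι → ℝ => ENNReal.ofReal (Theory2.coupleJac (p k) (χ' k) U))).foldl
        (fun (q : ((ι → ℝ) → (ι → ℝ)) × ((ι → ℝ) → ℝ≥0∞)) l => (l.1 ∘ q.1, fun z => q.2 z * l.2 (q.1 z)))
        (id, fun _ => 1)).2 := by
  refine hasJacobian_foldl_layers _ fun l hl => ?_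
  obtain ⟨k, -, rfl⟩ := List.mem_map.mp hl
  exact hasJacobian_boxCoupleFun (p k) (hχ k) (hχ' k) (hderiv k) (hmono k) (himage k) (hχ'0 k)

end Box

end Summit.Ventures.LatticeQCDFlow.Exactness
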